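import Summits.AtomisticToContinuum.Crystallization.Theorems.HullExactificationCascadeZeroDefectDensityCoordsFccBad
import HarnessLib

/-!
# Coordinates of a soft fcc shell — IV: the registered stub `stub_coordsFcc`
# (route `HullExactificationCascade`, crux `ZeroDefectDensity`, stmt-AtomisticToContinuum-12086; line `birth`)

Final file (lead c4, stub-worker) of the chain `…CoordsFccFrame → …CoordsFccGood → …CoordsFccBad`:
twelve points labelled by the fcc kissing pattern with norms `1 ± 1/4000` about `u`, contacts
`1 ± 1/4000`, square diagonals `|d² - 2| ≤ 38/4000` and `√3`-pairs `|d² - 3| ≤ 40/4000` admit a linear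
isometry `A` of `ℝ³` with `‖(τ q - u) - A q‖ ≤ 49/1000` for all twelve pattern points `q`.

* `fcc_chart'` — the enumeration `i ↦ fccTab i/√2` of the pattern (the chart of
  `…CapAtomsPattern`, with the formula and the three distance types exposed);
* `fcc_coords_all` — all `36` scaled coordinate errors are `≤ 1/25` (from `fcc_pt0 … fcc_pt11`);
* `stub_coordsFcc` — verbatim the registered signature: Gram data (`…CoordsFccFrame`), the frame
  (`fcc_frame`, `gs_orthonormal`), the isometry carrying the standard basis to the frame
  (`exists_linearIsometry_onb`) and Parseval (`norm_sub_map_sq_le`):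
  `‖p i - A qᵢ‖² ≤ 3 · (1/25)²/2 = 3/1250 < (49/1000)²`.

[folklore]
-/

noncomputable section

namespace Summit.AtomisticToContinuum.Crystallization.Theorems.ZeroDefectDensityBirth

open Real RealInnerProductSpace Literature.Geometry.DiscreteGeometry

/-! ### The chart with its formula -/

/-- The enumeration `i ↦ fccTab i /√2` is a bijection `Fin 12 ≃ fccKissingPattern`; contacts, square
diagonals and `√3`-pairs of the table are at distance `1`, `√2`, `√3`. [folklore] -/
theorem fcc_chart' : ∃ f : Fin 12 ≃ {q : EuclideanSpace ℝ (Fin 3) // q ∈ fccKissingPattern},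
    (∀ i, (f i).1 = (Real.sqrt 2)⁻¹ • intVec (fccTab i)) ∧
    (∀ i j, fccAdj i j → dist (f i).1 (f j).1 = 1) ∧
    (∀ i j, sqNormInt (fccTab i - fccTab j) = 4 → dist (f i).1 (f j).1 = Real.sqrt 2) ∧
    (∀ i j, sqNormInt (fccTab i - fccTab j) = 6 → dist (f i).1 (f j).1 = Real.sqrt 3) := by
  have hmem : ∀ i : Fin 12, (Real.sqrt 2)⁻¹ • intVec (fccTab i) ∈ fccKissingPattern := by
    intro i
    rw [fccKissingPattern, scaledPattern, fccInt_eq_image, Finset.image_image]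
    exact Finset.mem_image.2 ⟨i, Finset.mem_univ _, by simp⟩
  let g : Fin 12 → {q : EuclideanSpace ℝ (Fin 3) // q ∈ fccKissingPattern} :=
    fun i => ⟨(Real.sqrt 2)⁻¹ • intVec (fccTab i), hmem i⟩
  have hinj : Function.Injective g := by
    intro i j h
    have h' : (Real.sqrt 2)⁻¹ • intVec (fccTab i) = (Real.sqrt 2)⁻¹ • intVec (fccTab j) :=
      congrArg Subtype.val h
    have hc : (Real.sqrt 2)⁻¹ ≠ 0 := by positivity
    exact fccTab_injective (intVec_injective (smul_right_injective _ hc h'))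
  have hsurj : Function.Surjective g := by
    rintro ⟨q, hq⟩
    rw [fccKissingPattern, scaledPattern, fccInt_eq_image, Finset.image_image] at hq
    obtain ⟨i, -, rfl⟩ := Finset.mem_image.1 hq
    exact ⟨i, Subtype.ext (by simp [g])⟩
  have hd : ∀ i j, dist (g i).1 (g j).1 =
      (Real.sqrt 2)⁻¹ * Real.sqrt (sqNormInt (fccTab i - fccTab j) : ℝ) := by
    intro i j
    change dist ((Real.sqrt 2)⁻¹ • intVec (fccTab i)) ((Real.sqrt 2)⁻¹ • intVec (fccTab j)) = _
    rw [dist_eq_norm, ← smul_sub, intVec_sub, norm_smul, norm_inv,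
      Real.norm_of_nonneg (Real.sqrt_nonneg _), norm_intVec]
  refine ⟨Equiv.ofBijective g ⟨hinj, hsurj⟩, fun i => rfl, fun i j h => ?_, fun i j h => ?_,
    fun i j h => ?_⟩
  · change dist (g i).1 (g j).1 = 1
    rw [hd, h]
    push_cast
    rw [inv_mul_cancel₀ (by positivity)]
  · change dist (g i).1 (g j).1 = Real.sqrt 2
    rw [hd, h]
    push_cast
    rw [show (4 : ℝ) = 2 ^ 2 by norm_num, Real.sqrt_sq (by norm_num), inv_mul_eq_div,
      div_eq_iff (by positivity), Real.mul_self_sqrt (by norm_num)]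
  · change dist (g i).1 (g j).1 = Real.sqrt 3
    rw [hd, h]
    push_cast
    rw [show (6 : ℝ) = 2 * 3 by norm_num, Real.sqrt_mul (by norm_num),
      inv_mul_cancel_left₀ (by positivity)]

/-- Unscaling a coordinate bound: `|√2 a - t| ≤ B` gives `|a - t/√2| ≤ B/√2`. [folklore] -/
theorem coord_unscale {a t B : ℝ} (h : |Real.sqrt 2 * a - t| ≤ B) :
    |a - (Real.sqrt 2)⁻¹ * t| ≤ (Real.sqrt 2)⁻¹ * B := by
  have hs : (0 : ℝ) < Real.sqrt 2 := by positivity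
  have : a - (Real.sqrt 2)⁻¹ * t = (Real.sqrt 2)⁻¹ * (Real.sqrt 2 * a - t) := by
    field_simp
  rw [this, abs_mul, abs_of_pos (inv_pos.2 hs)]
  exact mul_le_mul_of_nonneg_left h (inv_pos.2 hs).le

/-! ### All twelve points -/

/-- **All twelve points**: every scaled coordinate `√2 ⟪p i, b_k⟫` is within `1/25` of `fccTab i k`.
[folklore] -/
theorem fcc_coords_all {p : Fin 12 → EuclideanSpace ℝ (Fin 3)} {b₁ b₂ b₃ : EuclideanSpace ℝ (Fin 3)} {n₁ n₂ n₃ s₂₁ s₃₁ s₃₂ : ℝ}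
    (hX : ∀ x : EuclideanSpace ℝ (Fin 3), ⟪x, b₁⟫ = ⟪x, p 0 + p 1⟫ / n₁)
    (hY : ∀ x : EuclideanSpace ℝ (Fin 3), ⟪x, b₂⟫ = (⟪x, p 0 - p 1⟫ - s₂₁ * ⟪x, b₁⟫) / n₂)
    (hZ : ∀ x : EuclideanSpace ℝ (Fin 3), ⟪x, b₃⟫ = (⟪x, p 4 - p 5⟫ - s₃₁ * ⟪x, b₁⟫ - s₃₂ * ⟪x, b₂⟫) / n₃)
    (hn₁ : |n₁ ^ 2 - 2| ≤ 141 / 10000) (hn₁0 : 0 < n₁) (hn₂ : |n₂ ^ 2 - 2| ≤ 141 / 10000)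
    (hn₂0 : 0 < n₂) (hn₃ : |n₃ ^ 2 - 2| ≤ 141 / 10000) (hn₃0 : 0 < n₃) (hs₂₁ : |s₂₁| ≤ 3 / 2000)
    (hs₃₁ : |s₃₁| ≤ 3 / 1000) (hs₃₂ : |s₃₂| ≤ 3 / 1000) (hub₁ : ‖b₁‖ = 1) (hub₂ : ‖b₂‖ = 1)
    (hP : ∀ x y : EuclideanSpace ℝ (Fin 3), ⟪x, y⟫ = ⟪x, b₁⟫ * ⟪y, b₁⟫ + ⟪x, b₂⟫ * ⟪y, b₂⟫ + ⟪x, b₃⟫ * ⟪y, b₃⟫)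
    (hnm : ∀ i, ‖p i‖ ≤ 1 + 1 / 4000) (hG0 : ∀ i, |⟪p i, p i⟫ - 1| ≤ 1 / 1000)
    (hG1 : ∀ i j, fccAdj i j → |⟪p i, p j⟫ - 1 / 2| ≤ 1 / 1000)
    (hG2 : ∀ i j, sqNormInt (fccTab i - fccTab j) = 4 → |⟪p i, p j⟫| ≤ 3 / 500)
    (hG3 : ∀ i j, sqNormInt (fccTab i - fccTab j) = 6 → |⟪p i, p j⟫ + 1 / 2| ≤ 3 / 500) :
    ∀ i : Fin 12, |Real.sqrt 2 * ⟪p i, b₁⟫ - fccTab i 0| ≤ 1 / 25 ∧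
      |Real.sqrt 2 * ⟪p i, b₂⟫ - fccTab i 1| ≤ 1 / 25 ∧ |Real.sqrt 2 * ⟪p i, b₃⟫ - fccTab i 2| ≤ 1 / 25 := by
  have hV1 := fcc_V1 hX hY hZ hn₁ hn₁0 hn₂ hn₂0 hn₃ hn₃0 hs₂₁ hs₃₁ hs₃₂ hub₁ hub₂ hnm hG0 hG1 hG2
  have hV2 := fcc_V2 hX hY hZ hn₁ hn₁0 hn₂ hn₂0 hn₃ hn₃0 hs₂₁ hs₃₁ hs₃₂ hub₁ hub₂ hnm hG1 hG3
  have hV3 := fcc_V3 hX hY hZ hn₁ hn₁0 hn₂ hn₂0 hn₃ hn₃0 hs₂₁ hs₃₁ hs₃₂ hub₁ hub₂ hnm hG1 hG3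
  intro i
  fin_cases i
  · obtain ⟨hx, hy, hz⟩ := fcc_pt0 hX hY hZ hn₁ hn₁0 hn₂ hn₂0 hn₃ hn₃0 hs₂₁ hs₃₁ hs₃₂ hub₁ hub₂ hnm hG0 hG1 hG2
    exact ⟨hx.trans (by norm_num), hy.trans (by norm_num), hz.trans (by norm_num)⟩
  · obtain ⟨hx, hy, hz⟩ := fcc_pt1 hX hY hZ hn₁ hn₁0 hn₂ hn₂0 hn₃ hn₃0 hs₂₁ hs₃₁ hs₃₂ hub₁ hub₂ hnm hG0 hG1 hG2
    exact ⟨hx.trans (by norm_num), hy.trans (by norm_num), hz.trans (by norm_num)⟩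
  · obtain ⟨hx, hy, hz⟩ := fcc_pt2 hZ hn₃ hn₃0 hs₃₁ hs₃₂ hub₁ hub₂ hP hnm hG1 hG3 hV1 hV2
    exact ⟨hx.trans (by norm_num), hy.trans (by norm_num), hz.trans (by norm_num)⟩
  · obtain ⟨hx, hy, hz⟩ := fcc_pt3 hZ hn₃ hn₃0 hs₃₁ hs₃₂ hub₁ hub₂ hP hnm hG3 hV1 hV2
    exact ⟨hx.trans (by norm_num), hy.trans (by norm_num), hz.trans (by norm_num)⟩
  · obtain ⟨hx, hy, hz⟩ := fcc_pt4 hX hY hZ hn₁ hn₁0 hn₂ hn₂0 hn₃ hn₃0 hs₂₁ hs₃₁ hs₃₂ hub₁ hub₂ hnm hG0 hG1 hG2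
    exact ⟨hx.trans (by norm_num), hy.trans (by norm_num), hz.trans (by norm_num)⟩
  · obtain ⟨hx, hy, hz⟩ := fcc_pt5 hX hY hZ hn₁ hn₁0 hn₂ hn₂0 hn₃ hn₃0 hs₂₁ hs₃₁ hs₃₂ hub₁ hub₂ hnm hG0 hG1 hG2
    exact ⟨hx.trans (by norm_num), hy.trans (by norm_num), hz.trans (by norm_num)⟩
  · obtain ⟨hx, hy, hz⟩ := fcc_pt6 hX hY hn₁ hn₁0 hn₂ hn₂0 hs₂₁ hub₁ hP hnm hG1 hG3 hV3
    exact ⟨hx.trans (by norm_num), hy.trans (by norm_num), hz.trans (by norm_num)⟩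
  · obtain ⟨hx, hy, hz⟩ := fcc_pt7 hX hY hn₁ hn₁0 hn₂ hn₂0 hs₂₁ hub₁ hP hnm hG1 hG3 hV3
    exact ⟨hx.trans (by norm_num), hy.trans (by norm_num), hz.trans (by norm_num)⟩
  · obtain ⟨hx, hy, hz⟩ := fcc_pt8 hX hY hZ hn₁ hn₁0 hn₂ hn₂0 hn₃ hn₃0 hs₂₁ hs₃₁ hs₃₂ hub₁ hub₂ hnm hG1 hG3
    exact ⟨hx.trans (by norm_num), hy.trans (by norm_num), hz.trans (by norm_num)⟩
  · obtain ⟨hx, hy, hz⟩ := fcc_pt9 hX hY hZ hn₁ hn₁0 hn₂ hn₂0 hn₃ hn₃0 hs₂₁ hs₃₁ hs₃₂ hub₁ hub₂ hnm hG1 hG3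
    exact ⟨hx.trans (by norm_num), hy.trans (by norm_num), hz.trans (by norm_num)⟩
  · obtain ⟨hx, hy, hz⟩ := fcc_pt10 hX hY hZ hn₁ hn₁0 hn₂ hn₂0 hn₃ hn₃0 hs₂₁ hs₃₁ hs₃₂ hub₁ hub₂ hnm hG1 hG3
    exact ⟨hx.trans (by norm_num), hy.trans (by norm_num), hz.trans (by norm_num)⟩
  · obtain ⟨hx, hy, hz⟩ := fcc_pt11 hX hY hZ hn₁ hn₁0 hn₂ hn₂0 hn₃ hn₃0 hs₂₁ hs₃₁ hs₃₂ hub₁ hub₂ hnm hG1 hG3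
    exact ⟨hx.trans (by norm_num), hy.trans (by norm_num), hz.trans (by norm_num)⟩

/-! ### The registered stub -/

/-- **Registered stub `stub_coordsFcc`** (line `birth` of crux `ZeroDefectDensity`, lead c4): twelve points
labelled by the fcc kissing pattern with norms `1 ± 1/4000` about `u`, contacts `1 ± 1/4000`, square
diagonals `|d² - 2| ≤ 38/4000` and `√3`-pairs `|d² - 3| ≤ 40/4000` admit a linear isometry `A` with
`‖(τ q - u) - A q‖ ≤ 49/1000` for all twelve `q`.  Verbatim the registered one-line signature. [folklore] -/
theorem stub_coordsFcc : ∀ (u : EuclideanSpace ℝ (Fin 3)) (τ : {q : EuclideanSpace ℝ (Fin 3) // q ∈ Literature.Geometry.DiscreteGeometry.fccKissingPattern} → EuclideanSpace ℝ (Fin 3)), (∀ q : {q : EuclideanSpace ℝ (Fin 3) // q ∈ Literature.Geometry.DiscreteGeometry.fccKissingPattern}, 1 - 1 / 4000 ≤ dist u (τ q) ∧ dist u (τ q) ≤ 1 + 1 / 4000) → (∀ q q' : {q : EuclideanSpace ℝ (Fin 3) // q ∈ Literature.Geometry.DiscreteGeometry.fccKissingPattern}, dist q.1 q'.1 = 1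 → 1 - 1 / 4000 ≤ dist (τ q) (τ q') ∧ dist (τ q) (τ q') ≤ 1 + 1 / 4000) → (∀ q q' : {q : EuclideanSpace ℝ (Fin 3) // q ∈ Literature.Geometry.DiscreteGeometry.fccKissingPattern}, dist q.1 q'.1 = Real.sqrt 2 → |dist (τ q) (τ q') ^ 2 - 2| ≤ 38 / 4000) → (∀ q q' : {q : EuclideanSpace ℝ (Fin 3) // q ∈ Literature.Geometry.DiscreteGeometry.fccKissingPattern}, dist q.1 q'.1 = Real.sqrt 3 → |dist (τ q) (τ q') ^ 2 - 3| ≤ 40 / 4000) → ∃ A : EuclideanSpace ℝ (Fin 3) →ₗᵢ[ℝ] EuclideanSpace ℝ (Fin 3), ∀ q : {q : EuclideanSpace ℝ (Fin 3) // q ∈ Literature.Geometry.DiscreteGeometry.fccKissingPattern}, ‖(τ q - u) - A q.1‖ ≤ 49 / 1000 := by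
  intro u τ H1 H2 H3 H4
  obtain ⟨f, hf, hf1, hf2, hf3⟩ := fcc_chart'
  obtain ⟨p, hp⟩ : ∃ p : Fin 12 → EuclideanSpace ℝ (Fin 3), ∀ i, p i = τ (f i) - u := ⟨_, fun _ => rfl⟩
  have hn : ∀ i, 1 - 1 / 4000 ≤ ‖p i‖ ∧ ‖p i‖ ≤ 1 + 1 / 4000 := fun i => by
    rw [hp, ← dist_eq_norm, dist_comm]; exact H1 (f i)
  have hnm : ∀ i, ‖p i‖ ≤ 1 + 1 / 4000 := fun i => (hn i).2
  have hpd : ∀ i j, ‖p i - p j‖ = dist (τ (f i)) (τ (f j)) := fun i j => by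
    rw [hp, hp, dist_eq_norm, sub_sub_sub_cancel_right]
  have hG0 : ∀ i, |⟪p i, p i⟫ - 1| ≤ 1 / 1000 := fun i => inner_self_bound (hn i)
  have hG1 : ∀ i j, fccAdj i j → |⟪p i, p j⟫ - 1 / 2| ≤ 1 / 1000 := fun i j h =>
    inner_contact_bound (hn i) (hn j) (by rw [hpd]; exact H2 (f i) (f j) (hf1 i j h))
  have hG2 : ∀ i j, sqNormInt (fccTab i - fccTab j) = 4 → |⟪p i, p j⟫| ≤ 3 / 500 := fun i j h =>
    inner_sqrt2_bound (hn i) (hn j) (by rw [hpd]; exact H3 (f i) (f j) (hf2 i j h))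
  have hG3 : ∀ i j, sqNormInt (fccTab i - fccTab j) = 6 → |⟪p i, p j⟫ + 1 / 2| ≤ 3 / 500 :=
    fun i j h => inner_sqrt3_bound (hn i) (hn j) (by rw [hpd]; exact H4 (f i) (f j) (hf3 i j h))
  -- the Gram–Schmidt frame
  obtain ⟨b₁, hb₁⟩ : ∃ b₁ : EuclideanSpace ℝ (Fin 3), b₁ = ‖p 0 + p 1‖⁻¹ • (p 0 + p 1) := ⟨_, rfl⟩
  obtain ⟨b₂, hb₂⟩ : ∃ b₂ : EuclideanSpace ℝ (Fin 3),
      b₂ = ‖(p 0 - p 1) - ⟪p 0 - p 1, b₁⟫ • b₁‖⁻¹ • ((p 0 - p 1) - ⟪p 0 - p 1, b₁⟫ • b₁) := ⟨_, rfl⟩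
  obtain ⟨b₃, hb₃⟩ : ∃ b₃ : EuclideanSpace ℝ (Fin 3), b₃ = ‖(p 4 - p 5) - ⟪p 4 - p 5, b₁⟫ • b₁ - ⟪p 4 - p 5, b₂⟫ • b₂‖⁻¹ •
      ((p 4 - p 5) - ⟪p 4 - p 5, b₁⟫ • b₁ - ⟪p 4 - p 5, b₂⟫ • b₂) := ⟨_, rfl⟩
  obtain ⟨⟨hv1, hn₁0, hn₁⟩, hs₂₁, ⟨hw2, hn₂0, hn₂⟩, hs₃₁, hs₃₂, ⟨hw3, hn₃0, hn₃⟩, hub₁, hub₂, -⟩ :=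
    fcc_frame p b₁ b₂ hG0 hG1 hG2 hb₁ hb₂
  have hON : Orthonormal ℝ ![b₁, b₂, b₃] := gs_orthonormal hv1 hb₁ hw2 hb₂ hw3 hb₃
  obtain ⟨C, hC⟩ := exists_orthonormalBasis_of_orthonormal hON
  have hP : ∀ x y : EuclideanSpace ℝ (Fin 3), ⟪x, y⟫ = ⟪x, b₁⟫ * ⟪y, b₁⟫ + ⟪x, b₂⟫ * ⟪y, b₂⟫ + ⟪x, b₃⟫ * ⟪y, b₃⟫ := by
    intro x y
    rw [← C.sum_inner_mul_inner x y, Fin.sum_univ_three, hC]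
    simp only [Matrix.cons_val_zero, Matrix.cons_val_one, Matrix.cons_val_two, Matrix.head_cons,
      Matrix.tail_cons, real_inner_comm b₁, real_inner_comm b₂, real_inner_comm b₃]
  have hX : ∀ x : EuclideanSpace ℝ (Fin 3), ⟪x, b₁⟫ = ⟪x, p 0 + p 1⟫ / ‖p 0 + p 1‖ := fun x => by rw [hb₁, inner_gs₁]
  have hY : ∀ x : EuclideanSpace ℝ (Fin 3), ⟪x, b₂⟫ = (⟪x, p 0 - p 1⟫ - ⟪p 0 - p 1, b₁⟫ * ⟪x, b₁⟫) /
      ‖(p 0 - p 1) - ⟪p 0 - p 1, b₁⟫ • b₁‖ := fun x => by rw [hb₂, inner_gs_residual]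
  have hZ : ∀ x : EuclideanSpace ℝ (Fin 3), ⟪x, b₃⟫ = (⟪x, p 4 - p 5⟫ - ⟪p 4 - p 5, b₁⟫ * ⟪x, b₁⟫ - ⟪p 4 - p 5, b₂⟫ * ⟪x, b₂⟫) /
      ‖(p 4 - p 5) - ⟪p 4 - p 5, b₁⟫ • b₁ - ⟪p 4 - p 5, b₂⟫ • b₂‖ := fun x => by
    rw [hb₃, inner_gs_residual₂]
  have hall := fcc_coords_all hX hY hZ hn₁ hn₁0 hn₂ hn₂0 hn₃ hn₃0 hs₂₁ hs₃₁ hs₃₂ hub₁ hub₂ hP hnm hG0 hG1 hG2 hG3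
  -- the isometry and Parseval
  obtain ⟨A, hA⟩ := exists_linearIsometry_onb (EuclideanSpace.basisFun (Fin 3) ℝ) C
  refine ⟨A, fun q => ?_⟩
  obtain ⟨i, rfl⟩ := f.surjective q
  rw [← hp i]
  have hsq : ‖p i - A (f i).1‖ ^ 2 ≤ ∑ _k : Fin 3, ((Real.sqrt 2)⁻¹ * (1 / 25)) ^ 2 := by
    refine norm_sub_map_sq_le (EuclideanSpace.basisFun (Fin 3) ℝ) C A hA (p i) (f i).1 _ fun k => ?_
    have hq : ⟪(f i).1, (EuclideanSpace.basisFun (Fin 3) ℝ) k⟫ = (Real.sqrt 2)⁻¹ * (fccTab i k : ℝ) := by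
      rw [hf i]
      simp [EuclideanSpace.basisFun_apply, EuclideanSpace.inner_single_right, intVec_apply]
    rw [hq, hC]
    obtain ⟨hx, hy, hz⟩ := hall i
    fin_cases k
    · exact coord_unscale hx
    · exact coord_unscale hy
    · exact coord_unscale hz
  have hs : ((Real.sqrt 2)⁻¹ * (1 / 25) : ℝ) ^ 2 = 1 / 1250 := by
    rw [mul_pow, inv_pow, Real.sq_sqrt (by norm_num)]; norm_num
  rw [hs, Fin.sum_univ_three] at hsq
  nlinarith [norm_nonneg (p i - A (f i).1), hsq]

end Summit.AtomisticToContinuum.Crystallization.Theorems.ZeroDefectDensityBirth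

end
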